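import Mathlib

/-!
# P5Dim8Tbar2222 — the 26 T̄ classes of the block structure (2,2,2,2) and their S₄-orbits (P5-Dim8Census-v3 Lemma 2.4.1)

Kernel-checked finite arithmetic by `decide` (README §2 / R-5: a supporting artefact, never the discharge of a
Hodge-theoretic step) for the bookkeeping half of Lemma 2.4.1 of proofs/P5-Dim8Census-v3.md:

* a block-swap vector of the structure (2,2,2,2) is an element of F₂⁴ encoded as a bitmask `0..15` (bit `b` set ⇔ the two
  ι-pairs of the surface block `b` are swapped); a SET of such vectors is encoded as a 16-bit mask `m` (bit `x` of `m` set ⇔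
  the vector `x` is in the set); a subgroup of F₂⁴ = a set containing `0` and closed under `xor`;
* `gens` = the generator lists of the 26 T̄ classes exactly as the deposited stage-A files
  `proofs/p5-scripts/dim8-ts-2222/ts_2_2_2_2_k.json.gz` (k = 0 … 25, SHA256SUMS 63e2266b…) carry them (each permutation of the
  8 points read as its block-swap vector); `classes` = their spans (xor-closures).

Certified (`decide`): the 26 spans are pairwise distinct subgroups of F₂⁴, each has FULL SUPPORT (every block is swapped by
some element), their orders are 2 (one class), 4 (thirteen), 8 (eleven), 16 (one); the list of spans is invariant under the
three adjacent transpositions of the blocks (hence under the whole S₄); the orbit partition of the 26 indices under these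
transpositions is exactly the one of Lemma 2.4.1: {0}, {1, 2, 5, 10}, {3, 6, 8}, {4, 7, 9, 11, 12, 13},
{14, 15, 16, 18, 19, 21}, {17, 20, 22, 23}, {24}, {25}; and COMPLETENESS: every 16-bit mask that is a subgroup of F₂⁴ with
full support is one of the 26 (so the 26 T̄ classes are all the subgroups of F₂⁴ with full support — the count
1 + 13 + 11 + 1 = 26 of the Lemma).

Closure under `xor` is decided through `xorT x m` = the image of the set `m` under `y ↦ x xor y`, computed as the composition
of the four bit-block swaps (xor by 1, 2, 4, 8 permute the 16 positions by swapping adjacent blocks of width 1, 2, 4, 8):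
`m` is xor-closed iff `xorT x m = m` for every `x ∈ m`.

NOT certified here: anything about the census itself (the S₄-equivariance of the counts is the text's Lemma 2.4.1; the
constancy of the counts on the orbits is read off the deposited data in §2.4 / Appendix C).
-/

namespace HodgeRepro0.P5Dim8Tbar2222

/-- the generator lists of the 26 T̄ classes (block-swap vectors as bitmasks), in the stage-A file order k = 0 … 25 -/
def gens : List (List ℕ) :=
  [[15], [8, 7], [4, 11], [12, 3], [12, 11], [2, 13], [10, 5], [10, 13], [6, 9], [6, 13], [14, 1], [14, 9], [14, 5],
   [14, 13], [8, 4, 3], [8, 2, 5], [8, 6, 1], [8, 6, 5], [4, 2, 9], [4, 10, 1], [4, 10, 9], [12, 2, 1], [12, 2, 9],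
   [12, 10, 1], [12, 10, 9], [8, 4, 2, 1]]

/-- the mask of a list of vectors -/
def maskOf (l : List ℕ) : ℕ := l.foldl (fun m x => m ||| (1 <<< x)) 0

/-- the vectors of a mask -/
def elems (m : ℕ) : List ℕ := (List.range 16).filter (fun x => m.testBit x)

/-- the image of the set `m` under `y ↦ 1 xor y` (swap adjacent positions) -/
def x1 (m : ℕ) : ℕ := ((m &&& 0x5555) <<< 1) ||| ((m &&& 0xAAAA) >>> 1)
/-- the image of the set `m` under `y ↦ 2 xor y` (swap adjacent pairs of positions) -/
def x2 (m : ℕ) : ℕ := ((m &&& 0x3333) <<< 2) ||| ((m &&& 0xCCCC) >>> 2)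
/-- the image of the set `m` under `y ↦ 4 xor y` (swap adjacent quadruples of positions) -/
def x4 (m : ℕ) : ℕ := ((m &&& 0x0F0F) <<< 4) ||| ((m &&& 0xF0F0) >>> 4)
/-- the image of the set `m` under `y ↦ 8 xor y` (swap the two halves) -/
def x8 (m : ℕ) : ℕ := ((m &&& 0x00FF) <<< 8) ||| ((m &&& 0xFF00) >>> 8)

/-- the image of the set `m` under `y ↦ x xor y` -/
def xorT (x m : ℕ) : ℕ :=
  let m1 := if x.testBit 0 then x1 m else m
  let m2 := if x.testBit 1 then x2 m1 else m1
  let m3 := if x.testBit 2 then x4 m2 else m2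
  if x.testBit 3 then x8 m3 else m3

/-- `m` is a subgroup of F₂⁴: contains 0 and is closed under xor (`xorT x m = m` for every `x ∈ m`) -/
def isSubgroup (m : ℕ) : Bool := m.testBit 0 && (elems m).all (fun x => xorT x m == m)

/-- one closure step: `m ∪ ⋃_{x ∈ m} xorT x m` (all sums of two elements) -/
def step (m : ℕ) : ℕ := (elems m).foldl (fun acc x => acc ||| xorT x m) m
/-- the span of a generator list: start from `{0} ∪ gens`, close under xor by four doublings -/
def span (g : List ℕ) : ℕ := step (step (step (step (maskOf (0 :: g)))))

/-- the 26 T̄ classes as masks -/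
def classes : List ℕ := gens.map span

/-- full support: every block `b` is swapped by some element -/
def fullSupport (m : ℕ) : Bool := (List.range 4).all (fun b => (elems m).any (fun x => x.testBit b))

/-- the order of the subgroup -/
def order (m : ℕ) : ℕ := (elems m).length

/-- the transposition of the blocks `i` and `j` acting on a vector -/
def swapBits (i j x : ℕ) : ℕ :=
  let bi := x.testBit i
  let bj := x.testBit j
  let x' := (x &&& (15 ^^^ ((1 <<< i) ||| (1 <<< j))))
  x' ||| (if bj then 1 <<< i else 0) ||| (if bi then 1 <<< j else 0)

/-- the transposition acting on a mask (a set of vectors) -/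
def swapMask (i j m : ℕ) : ℕ := maskOf ((elems m).map (swapBits i j))

/-- the three adjacent transpositions (0 1), (1 2), (2 3) generate S₄ -/
def transpositions : List (ℕ × ℕ) := [(0, 1), (1, 2), (2, 3)]

/-- the index of a mask in `classes` (26 if absent) -/
def indexOf (m : ℕ) : ℕ := (classes.findIdx? (fun c => c == m)).getD 26

/-- the images of the class `k` under the three transpositions, as indices -/
def images (k : ℕ) : List ℕ := transpositions.map (fun ij => indexOf (swapMask ij.1 ij.2 (classes.getD k 0)))

/-- one step of the orbit closure on a 26-bit mask of indices: add the images of every index in the mask -/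
def orbitStep (s : ℕ) : ℕ :=
  ((List.range 26).filter (fun k => s.testBit k)).foldl (fun acc k => acc ||| maskOf (images k)) s
/-- the orbit of the index `k` as a 26-bit mask: closure under `images`, 26 iterations -/
def orbitMask (k : ℕ) : ℕ := Nat.iterate orbitStep 26 (1 <<< k)

/-- the orbit partition of Lemma 2.4.1 -/
def orbitsOfRecord : List (List ℕ) :=
  [[0], [1, 2, 5, 10], [3, 6, 8], [4, 7, 9, 11, 12, 13], [14, 15, 16, 18, 19, 21], [17, 20, 22, 23], [24], [25]]

/-- (1) 26 pairwise distinct subgroups of F₂⁴ with full support -/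
theorem classes_distinct_subgroups_fullSupport :
    classes.length = 26 ∧ classes.Nodup ∧ classes.all isSubgroup = true ∧ classes.all fullSupport = true := by
  decide +kernel

/-- (2) the orders: 2 once, 4 thirteen times, 8 eleven times, 16 once -/
theorem classes_orders :
    (classes.filter (fun m => order m == 2)).length = 1 ∧ (classes.filter (fun m => order m == 4)).length = 13 ∧
    (classes.filter (fun m => order m == 8)).length = 11 ∧ (classes.filter (fun m => order m == 16)).length = 1 := by
  decide +kernel

/-- (3) the list of classes is invariant under the three adjacent transpositions of the blocks (hence under S₄) -/
theorem classes_S4_invariant :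
    transpositions.all (fun ij => classes.all (fun m => classes.contains (swapMask ij.1 ij.2 m))) = true := by
  decide +kernel

/-- (4) the S₄-orbits of the 26 indices are exactly those of Lemma 2.4.1 -/
theorem classes_orbits :
    orbitsOfRecord.all (fun o => o.all (fun k => orbitMask k == maskOf o)) = true ∧
    (orbitsOfRecord.flatMap id).length = 26 ∧
    (List.range 26).all (fun k => (orbitsOfRecord.flatMap id).contains k) = true := by
  decide +kernel

/-- (5) completeness, in four chunks of 16384 masks each: every 16-bit mask `m = (64 c + a) · 256 + b` that is a subgroup of
F₂⁴ with full support is one of the 26 classes -/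
theorem classes_complete_chunk (c : ℕ) (hc : c < 4) :
    (List.range 64).all (fun a => (List.range 256).all (fun b =>
      let m := (64 * c + a) * 256 + b
      !(isSubgroup m && fullSupport m) || classes.contains m)) = true := by
  interval_cases c <;> decide +kernel

/-- (5) completeness: every 16-bit mask that is a subgroup of F₂⁴ with full support is one of the 26 classes -/
theorem classes_complete (m : ℕ) (hm : m < 65536) (h : (isSubgroup m && fullSupport m) = true) :
    classes.contains m = true := by
  have hc := classes_complete_chunk (m / 16384) (by omega)
  rw [List.all_eq_true] at hc
  have h1 := hc ((m / 256) % 64) (List.mem_range.2 (by omega))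
  rw [List.all_eq_true] at h1
  have h2 := h1 (m % 256) (List.mem_range.2 (by omega))
  have hm' : (64 * (m / 16384) + (m / 256) % 64) * 256 + m % 256 = m := by omega
  simp only [hm', h, Bool.not_true, Bool.false_or] at h2
  exact h2

end HodgeRepro0.P5Dim8Tbar2222
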